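import Literature.Geometry.Manifold.LipschitzMollifierJacobian
import Summits.NavierStokesRegularity.NavierStokesRegularity.Theorems.AxisTwistDoorAveragedConeLiouvilleNUWeakDerivLip
import Mathlib.Analysis.Calculus.Gradient.Basic
import HarnessLib

/-!
# Route `AxisTwistDoor`, crux `AveragedConeLiouville` (stmt-NavierStokesRegularity-26889) — INPUT N4 / T1, piece W (N-W part 2),
# brick (a): THE DIVERGENCE-FREE CONDITION TRANSFERS FROM SMOOTH TO LIPSCHITZ COMPACTLY SUPPORTED TESTS

T1 kit `kits/N4-T1-skeleton.lean` 118454bf17607d1e (pub/ns-inputs, plan g6 14:00:36Z: W = `Sig.nu_weakEnergyIdentity →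
Sig.nu_standing_of_weak`).  The typed fact's drift `b` is only measurable, bounded on `W = ]0,T[ × B(0,1)` and divergence free
in `𝒟′(W)`: `∫_W ⟪b, ∇ₓφ⟫ = 0` for every `φ ∈ C^∞_c(W)`.  The energy argument tests it against the LIPSCHITZ compactly supported
function `η(t)χ(t)H(V)Θ²`; this file proves that transfer:

* `integral_inner_gradient_eq_zero_of_lipschitz` — for `w` Lipschitz on `ℝ × ℝ³` with compact support inside `W`,
  `∫_W ⟪b, ∇ₓ w⟫ = 0` (the a.e. slice gradient).

Proof (mollify the TEST, not the drift): transport `w` to `ℝ⁴ = EuclideanSpace ℝ (Fin 4)` by a linear isomorphism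
(`ContinuousLinearEquiv.ofFinrankEq`), mollify there (`Literature.Analysis.Convolution.mollify`), pull back: the mollified tests are
smooth, compactly supported inside `W` for small radius (`IsCompact.exists_cthickening_subset_open`), so the hypothesis applies; their
derivatives are the mollified a.e. derivative (`fderiv_mollify_of_lipschitz`, Kondo–Tanaka Lemma 2.3) and converge a.e. to the
a.e. derivative of `w` (Lebesgue differentiation, Mathlib `ContDiffBump.ae_convolution_tendsto_right_of_locallyIntegrable`;
null sets transported by uniqueness of Haar measure), boundedly (`‖D(J_ε g)‖ ≤ Lip g`); dominated convergence (`b ∈ L^∞(W)`).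

No NS statement is touched; T1 is an INPUT (a printed theorem re-proved); item 26889 and the summit are not affected.
`--supports stmt-NavierStokesRegularity-26889 --as helper`. [cite: NazarovUraltseva2011HarnackDivFree, §3 (arXiv:1011.1888 p. 8)]
-/

noncomputable section

-- the summit and its single sub-problem share the name (CONVENTIONS §1)
set_option linter.dupNamespace false

open MeasureTheory Set Function Filter Topology Metric
open scoped NNReal ENNReal Convolution
open Literature.Analysis.Convolution Literature.Geometry.Manifold

namespace Summit.NavierStokesRegularity.NavierStokesRegularity.Theorems.AveragedConeLiouville.NU

/-! ### Mollified derivatives of Lipschitz maps: bound and a.e. convergence -/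

section Mollify

variable {G : Type*} [NormedAddCommGroup G] [InnerProductSpace ℝ G] [FiniteDimensional ℝ G]
  [MeasurableSpace G] [BorelSpace G]

/-- `‖D(J_ε g)(x)‖ ≤ Lip g`: the mollified derivative is an average of the a.e. derivative. [folklore] -/
theorem norm_fderiv_mollify_le_of_lipschitz {g : G → ℝ} {K : ℝ≥0} (hg : LipschitzWith K g) (ε : ℝ) (x : G) :
    ‖fderiv ℝ (mollify ε g) x‖ ≤ K := by
  rw [fderiv_mollify_of_lipschitz hg ε x]
  refine (norm_integral_le_integral_norm _).trans ?_
  calc ∫ t, ‖mollifier ε t • fderiv ℝ g (x - t)‖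
      ≤ ∫ t, mollifier ε t * K := by
        refine integral_mono_of_nonneg (Eventually.of_forall fun t => norm_nonneg _)
          ((integrable_mollifier ε).mul_const _) (Eventually.of_forall fun t => ?_)
        show ‖mollifier ε t • fderiv ℝ g (x - t)‖ ≤ mollifier ε t * K
        rw [norm_smul, Real.norm_of_nonneg (mollifier_nonneg ε t)]
        exact mul_le_mul_of_nonneg_left (norm_fderiv_le_of_lipschitz ℝ hg) (mollifier_nonneg ε t)
    _ = K := by rw [integral_mul_const, integral_mollifier, one_mul]

/-- **A.e. convergence of the mollified derivatives**: `D(J_{1/(n+1)} g)(x) → Dg(x)` for a.e. `x`, for `g` Lipschitz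
(Lebesgue differentiation applied to the locally integrable a.e. derivative). [folklore] -/
theorem ae_tendsto_fderiv_mollify_of_lipschitz {g : G → ℝ} {K : ℝ≥0} (hg : LipschitzWith K g) :
    ∀ᵐ x ∂(volume : Measure G),
      Tendsto (fun n : ℕ => fderiv ℝ (mollify (1 / ((n : ℝ) + 1)) g) x) atTop (𝓝 (fderiv ℝ g x)) := by
  have hloc : LocallyIntegrable (fderiv ℝ g) (volume : Measure G) := locallyIntegrable_fderiv_of_lipschitz hg
  have hε : ∀ n : ℕ, (0 : ℝ) < 1 / ((n : ℝ) + 1) := fun n => by positivity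
  have hrOut : Tendsto (fun n : ℕ => (mollBump G (1 / ((n : ℝ) + 1))).rOut) atTop (𝓝 0) := by
    have h1 : Tendsto (fun n : ℕ => 2 * (1 / ((n : ℝ) + 1))) atTop (𝓝 (2 * 0)) :=
      tendsto_one_div_add_atTop_nhds_zero_nat.const_mul 2
    rw [mul_zero] at h1
    refine h1.congr fun n => ?_
    rw [mollBump_rOut (hε n)]
  have hratio : ∀ᶠ n : ℕ in atTop,
      (mollBump G (1 / ((n : ℝ) + 1))).rOut ≤ 2 * (mollBump G (1 / ((n : ℝ) + 1))).rIn :=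
    Eventually.of_forall fun n => by rw [mollBump_rOut (hε n), mollBump_rIn (hε n)]
  filter_upwards [ContDiffBump.ae_convolution_tendsto_right_of_locallyIntegrable hrOut hratio hloc] with x hx
  refine hx.congr fun n => ?_
  rw [fderiv_mollify_of_lipschitz hg, ← mollify_apply]
  rfl

end Mollify

/-! ### Null sets under a linear isomorphism onto `ℝ⁴` -/

/-- A.e. statements transport along a continuous linear isomorphism between finite-dimensional spaces with additive
Haar measures (the image measure is again an additive Haar measure, hence a multiple of the target's). [folklore] -/
theorem ae_comp_of_ae_continuousLinearEquiv {P Q : Type*} [NormedAddCommGroup P] [NormedSpace ℝ P] [FiniteDimensional ℝ P]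
    [MeasurableSpace P] [BorelSpace P] [NormedAddCommGroup Q] [NormedSpace ℝ Q] [FiniteDimensional ℝ Q]
    [MeasurableSpace Q] [BorelSpace Q] (μ : Measure P) [μ.IsAddHaarMeasure] (ν : Measure Q) [ν.IsAddHaarMeasure]
    (Ψ : P ≃L[ℝ] Q) {p : Q → Prop} (h : ∀ᵐ y ∂ν, p y) : ∀ᵐ x ∂μ, p (Ψ x) := by
  have hmap : (μ.map Ψ).IsAddHaarMeasure := Ψ.isAddHaarMeasure_map μ
  have heq : μ.map Ψ = (μ.map Ψ).addHaarScalarFactor ν • ν := Measure.isAddLeftInvariant_eq_smul _ _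
  have h1 : ∀ᵐ y ∂(μ.map Ψ), p y := by
    rw [heq]
    exact Measure.ae_smul_measure h _
  exact ae_of_ae_map Ψ.continuous.measurable.aemeasurable h1

/-! ### Slices of a Fréchet derivative -/

/-- The slice `y ↦ F (t, y)` of a map differentiable at `(t, x)` has gradient `toDual⁻¹ (DF(t,x) ∘ inr)` at `x`. [folklore] -/
theorem gradient_slice_eq_of_hasFDerivAt {F : ℝ × EuclideanSpace ℝ (Fin 3) → ℝ} {p : ℝ × EuclideanSpace ℝ (Fin 3)}
    {L : ℝ × EuclideanSpace ℝ (Fin 3) →L[ℝ] ℝ} (hF : HasFDerivAt F L p) :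
    gradient (fun y => F (p.1, y)) p.2 =
      (InnerProductSpace.toDual ℝ (EuclideanSpace ℝ (Fin 3))).symm
        (L.comp (ContinuousLinearMap.inr ℝ ℝ (EuclideanSpace ℝ (Fin 3)))) := by
  have h : HasFDerivAt (fun y => F (p.1, y)) (L.comp (ContinuousLinearMap.inr ℝ ℝ (EuclideanSpace ℝ (Fin 3)))) p.2 :=
    hF.comp p.2 (hasFDerivAt_prodMk_right p.1 p.2)
  rw [gradient, h.fderiv]

/-- `‖inr‖ ≤ 1` for the sup norm on the product. [folklore] -/
theorem norm_inr_le_one' :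
    ‖ContinuousLinearMap.inr ℝ ℝ (EuclideanSpace ℝ (Fin 3))‖ ≤ 1 := by
  refine ContinuousLinearMap.opNorm_le_bound _ zero_le_one fun v => ?_
  rw [one_mul, ContinuousLinearMap.inr_apply, Prod.norm_mk, norm_zero, max_eq_right (norm_nonneg _)]

/-! ### The transfer -/

set_option maxHeartbeats 1600000 in
/-- **The divergence-free condition passes from smooth to Lipschitz compactly supported tests.**  Let `b` be measurable on
`ℝ × ℝ³`, bounded on `W = ]0,T[ × B(0,1)`, with `∫_W ⟪b, ∇ₓφ⟫ = 0` for all `φ ∈ C^∞_c(W)` (the typed clause).  Then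
`∫_W ⟪b, ∇ₓw⟫ = 0` for every `w` Lipschitz on `ℝ × ℝ³` with compact support contained in `W` (`∇ₓw` the slice gradient, which
exists a.e.). [cite: NazarovUraltseva2011HarnackDivFree, §3 (arXiv:1011.1888 p. 8)] -/
theorem integral_inner_gradient_eq_zero_of_lipschitz {T : ℝ}
    {b : ℝ → EuclideanSpace ℝ (Fin 3) → EuclideanSpace ℝ (Fin 3)} {Λ : ℝ}
    (hbm : Measurable (uncurry b))
    (hbΛ : ∀ t ∈ Ioo 0 T, ∀ x ∈ ball (0 : EuclideanSpace ℝ (Fin 3)) 1, ‖b t x‖ ≤ Λ)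
    (hdiv : ∀ φ : ℝ → EuclideanSpace ℝ (Fin 3) → ℝ, ContDiff ℝ (⊤ : ℕ∞) (uncurry φ) →
        HasCompactSupport (uncurry φ) →
        tsupport (uncurry φ) ⊆ Ioo 0 T ×ˢ ball (0 : EuclideanSpace ℝ (Fin 3)) 1 →
        ∫ p in Ioo 0 T ×ˢ ball (0 : EuclideanSpace ℝ (Fin 3)) 1,
          inner ℝ (b p.1 p.2) (gradient (φ p.1) p.2) = 0)
    {w : ℝ → EuclideanSpace ℝ (Fin 3) → ℝ} {K : ℝ≥0} (hw : LipschitzWith K (uncurry w))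
    (hwc : HasCompactSupport (uncurry w))
    (hws : tsupport (uncurry w) ⊆ Ioo 0 T ×ˢ ball (0 : EuclideanSpace ℝ (Fin 3)) 1) :
    ∫ p in Ioo 0 T ×ˢ ball (0 : EuclideanSpace ℝ (Fin 3)) 1,
      inner ℝ (b p.1 p.2) (gradient (w p.1) p.2) = 0 := by
  -- the domain
  set W : Set (ℝ × EuclideanSpace ℝ (Fin 3)) := Ioo 0 T ×ˢ ball (0 : EuclideanSpace ℝ (Fin 3)) 1 with hWdef
  have hWo : IsOpen W := isOpen_Ioo.prod isOpen_ball
  -- transport to `ℝ⁴`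
  have hrank : Module.finrank ℝ (ℝ × EuclideanSpace ℝ (Fin 3)) = Module.finrank ℝ (EuclideanSpace ℝ (Fin 4)) := by
    simp [Module.finrank_prod]
  set Ψ : (ℝ × EuclideanSpace ℝ (Fin 3)) ≃L[ℝ] EuclideanSpace ℝ (Fin 4) :=
    ContinuousLinearEquiv.ofFinrankEq hrank with hΨdef
  set Ψc : (ℝ × EuclideanSpace ℝ (Fin 3)) →L[ℝ] EuclideanSpace ℝ (Fin 4) := (Ψ : (ℝ × EuclideanSpace ℝ (Fin 3)) →L[ℝ] EuclideanSpace ℝ (Fin 4)) with hΨc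
  set CΨ : ℝ := ‖(Ψ.symm : EuclideanSpace ℝ (Fin 4) →L[ℝ] ℝ × EuclideanSpace ℝ (Fin 3))‖ with hCΨ
  have hCΨ0 : 0 ≤ CΨ := norm_nonneg _
  set g : EuclideanSpace ℝ (Fin 4) → ℝ := uncurry w ∘ Ψ.symm with hgdef
  have hg : LipschitzWith (K * ‖(Ψ.symm : EuclideanSpace ℝ (Fin 4) →L[ℝ] ℝ × EuclideanSpace ℝ (Fin 3))‖₊) g :=
    hw.comp Ψ.symm.lipschitz
  set Kg : ℝ≥0 := K * ‖(Ψ.symm : EuclideanSpace ℝ (Fin 4) →L[ℝ] ℝ × EuclideanSpace ℝ (Fin 3))‖₊ with hKg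
  have hgc : HasCompactSupport g := hwc.comp_homeomorph Ψ.symm.toHomeomorph
  have hgw : ∀ p, g (Ψ p) = uncurry w p := fun p => by simp [hgdef]
  have hwg : uncurry w = g ∘ Ψ := funext fun p => (hgw p).symm
  have hgloc : LocallyIntegrable g volume := hg.continuous.locallyIntegrable
  -- the mollified tests `wn n = (J_{ε n} g) ∘ Ψ`
  set ε : ℕ → ℝ := fun n => 1 / ((n : ℝ) + 1) with hεdef
  have hε : ∀ n, 0 < ε n := fun n => by positivity
  set wn : ℕ → ℝ × EuclideanSpace ℝ (Fin 3) → ℝ := fun n => mollify (ε n) g ∘ Ψ with hwndef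
  have hmoll_diff : ∀ n, Differentiable ℝ (mollify (ε n) g) := fun n =>
    (contDiff_mollify (ε n) hgloc (n := 1)).differentiable one_ne_zero
  have hwn_smooth : ∀ n, ContDiff ℝ (⊤ : ℕ∞) (wn n) := fun n =>
    (contDiff_mollify (ε n) hgloc).comp Ψ.contDiff
  have hwn_cpt : ∀ n, HasCompactSupport (wn n) := fun n =>
    (hasCompactSupport_mollify (ε n) hgc).comp_homeomorph Ψ.toHomeomorph
  have hwn_deriv : ∀ n p, HasFDerivAt (wn n) ((fderiv ℝ (mollify (ε n) g) (Ψ p)).comp Ψc) p := fun n p =>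
    ((hmoll_diff n) (Ψ p)).hasFDerivAt.comp p Ψ.hasFDerivAt
  -- the supports of the mollified tests are eventually inside `W`
  obtain ⟨δ, hδ, hδW⟩ := (show IsCompact (tsupport (uncurry w)) from hwc).exists_cthickening_subset_open hWo hws
  have hwn_zero : ∀ n p, CΨ * (2 * ε n) ≤ δ → p ∉ cthickening δ (tsupport (uncurry w)) → wn n p = 0 := by
    intro n p hn hp
    show mollify (ε n) g (Ψ p) = 0
    refine mollify_eq_zero_of_ball (hε n) fun y hy => ?_
    by_contra hne
    have hmem : Ψ.symm y ∈ tsupport (uncurry w) := subset_tsupport _ (by simpa [hgdef] using hne)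
    apply hp
    refine Metric.mem_cthickening_of_dist_le p (Ψ.symm y) δ _ hmem ?_
    rw [mem_ball, dist_eq_norm] at hy
    calc dist p (Ψ.symm y) = ‖Ψ.symm (Ψ p - y)‖ := by
          rw [dist_eq_norm, map_sub, ContinuousLinearEquiv.symm_apply_apply]
      _ ≤ CΨ * ‖Ψ p - y‖ := Ψ.symm.toContinuousLinearMap.le_opNorm _
      _ ≤ CΨ * (2 * ε n) := by
          rw [← norm_neg, neg_sub]; exact mul_le_mul_of_nonneg_left hy.le hCΨ0
      _ ≤ δ := hn
  have hwn_tsupp : ∀ᶠ n : ℕ in atTop, tsupport (wn n) ⊆ W := by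
    have hev : ∀ᶠ n : ℕ in atTop, CΨ * (2 * ε n) ≤ δ := by
      have ht : Tendsto (fun n : ℕ => CΨ * (2 * ε n)) atTop (𝓝 (CΨ * (2 * 0))) :=
        (tendsto_one_div_add_atTop_nhds_zero_nat.const_mul 2).const_mul CΨ
      rw [mul_zero, mul_zero] at ht
      exact ht.eventually (ge_mem_nhds hδ)
    filter_upwards [hev] with n hn
    have hsupp : support (wn n) ⊆ cthickening δ (tsupport (uncurry w)) := fun p hp => by
      by_contra hpc
      exact hp (hwn_zero n p hn hpc)
    exact (closure_minimal hsupp isClosed_cthickening).trans hδW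
  -- the hypothesis on the mollified tests
  have hzero : ∀ᶠ n : ℕ in atTop,
      ∫ p in W, inner ℝ (b p.1 p.2) (gradient (fun y => wn n (p.1, y)) p.2) = 0 := by
    filter_upwards [hwn_tsupp] with n hn
    exact hdiv (fun t y => wn n (t, y)) (hwn_smooth n) (hwn_cpt n) hn
  -- the linear read-out `L ↦ toDual⁻¹ ((L ∘ Ψ) ∘ inr)` is continuous
  set rd : (EuclideanSpace ℝ (Fin 4) →L[ℝ] ℝ) → EuclideanSpace ℝ (Fin 3) := fun L =>
    (InnerProductSpace.toDual ℝ (EuclideanSpace ℝ (Fin 3))).symm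
      ((L.comp Ψc).comp (ContinuousLinearMap.inr ℝ ℝ (EuclideanSpace ℝ (Fin 3)))) with hrd
  have hrd_cont : Continuous rd := by
    have h1 : Continuous fun L : EuclideanSpace ℝ (Fin 4) →L[ℝ] ℝ => L.comp Ψc :=
      ((ContinuousLinearMap.compL ℝ (ℝ × EuclideanSpace ℝ (Fin 3)) (EuclideanSpace ℝ (Fin 4)) ℝ).flip Ψc).continuous
    have h2 : Continuous fun L : ℝ × EuclideanSpace ℝ (Fin 3) →L[ℝ] ℝ =>
        L.comp (ContinuousLinearMap.inr ℝ ℝ (EuclideanSpace ℝ (Fin 3))) :=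
      ((ContinuousLinearMap.compL ℝ (EuclideanSpace ℝ (Fin 3)) (ℝ × EuclideanSpace ℝ (Fin 3)) ℝ).flip
        (ContinuousLinearMap.inr ℝ ℝ (EuclideanSpace ℝ (Fin 3)))).continuous
    exact (InnerProductSpace.toDual ℝ (EuclideanSpace ℝ (Fin 3))).symm.continuous.comp (h2.comp h1)
  have hrd_norm : ∀ L, ‖rd L‖ ≤ ‖L‖ * ‖Ψc‖ := fun L => by
    rw [hrd]
    dsimp only
    rw [LinearIsometryEquiv.norm_map]
    calc ‖(L.comp Ψc).comp (ContinuousLinearMap.inr ℝ ℝ (EuclideanSpace ℝ (Fin 3)))‖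
        ≤ ‖L.comp Ψc‖ * ‖ContinuousLinearMap.inr ℝ ℝ (EuclideanSpace ℝ (Fin 3))‖ :=
          ContinuousLinearMap.opNorm_comp_le _ _
      _ ≤ (‖L‖ * ‖Ψc‖) * 1 := mul_le_mul (ContinuousLinearMap.opNorm_comp_le _ _) norm_inr_le_one'
          (norm_nonneg _) (by positivity)
      _ = ‖L‖ * ‖Ψc‖ := mul_one _
  -- the slice gradients of the mollified tests
  have hgrad_n : ∀ n p, gradient (fun y => wn n (p.1, y)) p.2 = rd (fderiv ℝ (mollify (ε n) g) (Ψ p)) :=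
    fun n p => gradient_slice_eq_of_hasFDerivAt (hwn_deriv n p)
  -- a.e.: the mollified derivatives converge at `Ψ p` and `g` is differentiable at `Ψ p`
  haveI hHaar : (volume : Measure (ℝ × EuclideanSpace ℝ (Fin 3))).IsAddHaarMeasure := by
    rw [Measure.volume_eq_prod]; infer_instance
  have hae : ∀ᵐ p ∂(volume : Measure (ℝ × EuclideanSpace ℝ (Fin 3))),
      Tendsto (fun n : ℕ => fderiv ℝ (mollify (1 / ((n : ℝ) + 1)) g) (Ψ p)) atTop (𝓝 (fderiv ℝ g (Ψ p))) ∧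
        DifferentiableAt ℝ g (Ψ p) :=
    ae_comp_of_ae_continuousLinearEquiv volume volume Ψ
      ((ae_tendsto_fderiv_mollify_of_lipschitz hg).and (hg.ae_differentiableAt (μ := volume)))
  have hlim_pt : ∀ᵐ p ∂(volume.restrict W),
      Tendsto (fun n : ℕ => inner ℝ (b p.1 p.2) (gradient (fun y => wn n (p.1, y)) p.2)) atTop
        (𝓝 (inner ℝ (b p.1 p.2) (gradient (w p.1) p.2))) := by
    filter_upwards [ae_restrict_of_ae (s := W) hae] with p hp
    obtain ⟨hT, hd⟩ := hp
    have hwd : HasFDerivAt (uncurry w) ((fderiv ℝ g (Ψ p)).comp Ψc) p := by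
      rw [hwg]
      exact hd.hasFDerivAt.comp p Ψ.hasFDerivAt
    have hgrad : gradient (w p.1) p.2 = rd (fderiv ℝ g (Ψ p)) :=
      gradient_slice_eq_of_hasFDerivAt (F := uncurry w) hwd
    simp_rw [hgrad_n, hgrad]
    exact (tendsto_const_nhds.inner ((hrd_cont.tendsto _).comp hT))
  -- domination on `W`
  have hbound : ∀ n, ∀ᵐ p ∂(volume.restrict W),
      ‖inner ℝ (b p.1 p.2) (gradient (fun y => wn n (p.1, y)) p.2)‖ ≤ Λ * (Kg * ‖Ψc‖) := by
    intro n
    filter_upwards [ae_restrict_mem (hWo.measurableSet)] with p hp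
    rw [hWdef, mem_prod] at hp
    have hb : ‖b p.1 p.2‖ ≤ Λ := hbΛ p.1 hp.1 p.2 hp.2
    rw [hgrad_n]
    refine (norm_inner_le_norm _ _).trans ?_
    refine mul_le_mul hb ((hrd_norm _).trans ?_) (norm_nonneg _) ((norm_nonneg _).trans hb)
    exact mul_le_mul_of_nonneg_right (norm_fderiv_mollify_le_of_lipschitz hg (ε n) (Ψ p)) (norm_nonneg _)
  -- measurability of the integrands
  have hmeas : ∀ n, AEStronglyMeasurable
      (fun p : ℝ × EuclideanSpace ℝ (Fin 3) => inner ℝ (b p.1 p.2) (gradient (fun y => wn n (p.1, y)) p.2))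
      (volume.restrict W) := by
    intro n
    have hc : Continuous fun p : ℝ × EuclideanSpace ℝ (Fin 3) => gradient (fun y => wn n (p.1, y)) p.2 := by
      have e : (fun p : ℝ × EuclideanSpace ℝ (Fin 3) => gradient (fun y => wn n (p.1, y)) p.2) =
          fun p => rd (fderiv ℝ (mollify (ε n) g) (Ψ p)) := funext fun p => hgrad_n n p
      rw [e]
      exact hrd_cont.comp (((contDiff_mollify (ε n) hgloc (n := 1)).continuous_fderiv one_ne_zero).comp Ψ.continuous)
    exact (hbm.aestronglyMeasurable.inner hc.aestronglyMeasurable).restrict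
  -- dominated convergence
  haveI : IsFiniteMeasure (volume.restrict W) := by
    refine ⟨?_⟩
    rw [Measure.restrict_apply_univ, hWdef, Measure.volume_eq_prod, Measure.prod_prod]
    exact ENNReal.mul_lt_top measure_Ioo_lt_top measure_ball_lt_top
  have hlim : Tendsto (fun n : ℕ => ∫ p in W, inner ℝ (b p.1 p.2) (gradient (fun y => wn n (p.1, y)) p.2))
      atTop (𝓝 (∫ p in W, inner ℝ (b p.1 p.2) (gradient (w p.1) p.2))) :=
    tendsto_integral_of_dominated_convergence (fun _ => Λ * (Kg * ‖Ψc‖)) hmeas (integrable_const _)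
      hbound hlim_pt
  have hlim0 : Tendsto (fun n : ℕ => ∫ p in W, inner ℝ (b p.1 p.2) (gradient (fun y => wn n (p.1, y)) p.2))
      atTop (𝓝 0) :=
    tendsto_const_nhds.congr' (hzero.mono fun n hn => hn.symm)
  exact tendsto_nhds_unique hlim hlim0

end Summit.NavierStokesRegularity.NavierStokesRegularity.Theorems.AveragedConeLiouville.NU

end
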